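import Mathlib
import HarnessLib
import Summits.ValiantsHypothesis.ValiantsHypothesis.Theses.MonotoneRestoration
import Literature.Computability.AlgebraicComplexity.ArithCircuit
import Literature.Computability.AlgebraicComplexity.ArithCircuitProofs
import Literature.Computability.AlgebraicComplexity.MonotoneStructure
import Literature.Computability.AlgebraicComplexity.PermanentIrreducible
import Literature.ModelTheory.FiniteModelTheory.CkEquiv
import Summits.ValiantsHypothesis.ValiantsHypothesis.Theorems.MonotoneRestorationMonotoneRestorationQPCosetCount
import Summits.ValiantsHypothesis.ValiantsHypothesis.Theorems.MonotoneRestorationMonotoneRestorationQPSymmetricLB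
import Summits.ValiantsHypothesis.ValiantsHypothesis.Theorems.MonotoneRestorationMonotoneRestorationQPSupportSymmetrisation
import Summits.ValiantsHypothesis.ValiantsHypothesis.Theorems.MonotoneRestorationMonotoneRestorationQPSparseRegime
import Summits.ValiantsHypothesis.ValiantsHypothesis.Theorems.MonotoneRestorationMonotoneRestorationQPBeta
import Literature.Computability.AlgebraicComplexity.SymmetricArithCircuit
import Literature.Computability.AlgebraicComplexity.DawarWilsenach2025Proofs
import Literature.GroupTheory.PermutationGroups.SmallIndexSubgroups
import Literature.GroupTheory.PermutationGroups.SmallIndexSubgroupsAlternating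
import Summits.ValiantsHypothesis.ValiantsHypothesis.Theorems.MonotoneRestorationQP.Negative.LoadBearing
import Summits.ValiantsHypothesis.ValiantsHypothesis.Theorems.MonotoneRestorationMonotoneRestorationQPPermSupportCount

/-! TTRL-lite variant V18994 of stmt-ValiantsHypothesis-15886

Orbit form of Jordan's bound over an abstract `Alt(β)`-set (Dixon–Mortimer, *Permutation
Groups*, Thm 5.2A with `r = 1`; Rotman 1995, Cor 3.15 with Thm 3.11): if `|β| ≥ 5` and the
`Alt(β)`-orbit of a point `q` lies inside a finite set `T` with `|T| < |β|`, then `Alt(β)` fixes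
`q`.  By orbit–stabiliser (`MulAction.index_stabilizer`) the stabiliser of `q` has index
`= |orbit| ≤ |T| < |β|`, and a subgroup of `Alt(β)` of index `< |β|` is everything (normal core +
simplicity of `Alt(β)`, `|Alt(β)| = |β|!/2 > (|β| - 1)!`).  This is literally the tree's
`Literature.GroupTheory.PermutationGroups.alternatingGroup_smul_eq_self_of_orbit_subset`
(universe-specialised to `Type`), which we reuse rather than restate.
-/

-- `Summit.ValiantsHypothesis.ValiantsHypothesis.…` is the tree's mandated single-conjunct layout
-- (Sub = Summit), so the duplicated namespace component is intended.
set_option linter.dupNamespace false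

namespace Summit.ValiantsHypothesis.ValiantsHypothesis.Theorems

open Summit.ValiantsHypothesis.ValiantsHypothesis.Theses.MonotoneRestoration
open Literature.Computability.AlgebraicComplexity

/-- **Orbit form of Jordan's bound** (TTRL-lite variant V18994 of
`stub_altFixing_orbit_dichotomy`, item stmt-ValiantsHypothesis-15886): in an `Alt(β)`-set with
`5 ≤ |β|`, a point `q` whose whole orbit lies in a finset `T` with `T.card < |β|` is fixed by every
element of `Alt(β)`.  Direct application of
`Literature.GroupTheory.PermutationGroups.alternatingGroup_smul_eq_self_of_orbit_subset`
(orbit–stabiliser `MulAction.index_stabilizer` + no proper subgroup of `Alt(β)` of index `< |β|`).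
[cite: DixonMortimer1996, Thm 5.2A (r = 1); Rotman1995, Thm 3.11, Cor 3.15] -/
theorem stub_altFixing_orbit_dichotomy_var18994 :
    ∀ (β : Type) [Fintype β] [DecidableEq β] (γ : Type) [MulAction (alternatingGroup β) γ]
      (q : γ) (T : Finset γ), 5 ≤ Fintype.card β → T.card < Fintype.card β →
      (∀ g : alternatingGroup β, g • q ∈ T) → ∀ g : alternatingGroup β, g • q = q := by
  intro β _ _ γ _ q T h5 hT horb
  exact Literature.GroupTheory.PermutationGroups.alternatingGroup_smul_eq_self_of_orbit_subset
    h5 q T hT horb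

end Summit.ValiantsHypothesis.ValiantsHypothesis.Theorems
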